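import Summits.Ventures.Crystal3D.StickySpheres.SevenCensusSearch
import Summits.Ventures.Crystal3D.StickySpheres.PrismLink
import Summits.Ventures.Crystal3D.StickySpheres.ContactSeven
import HarnessLib

/-!
# The seven-ball census at graph level: a fifteen-contact packing of seven balls has one of five contact graphs

Venture `Crystal3D` (cell `pub-crystal3d`, seat p2). PROVED OUTRIGHT (`seven_census`): if seven unit-diameter balls in `ℝ³`
with pairwise centre distances `≥ 1` have exactly fifteen touching pairs (the maximum, `C(7) = 15`, `ContactSeven.lean`), then
after relabelling the balls the set of touching pairs is EXACTLY the edge set of a labelled copy of one of the five graphs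
`bipyr` (pentagonal bipyramid), `axial` (four tetrahedra about an edge), `tricap` (tri-capped tetrahedron), `capoct` (capped
octahedron), `helix` (four-tetrahedra helix) of `SevenCensusPatterns.lean` — the contact graphs of the five seven-ball
clusters of the Arkus–Manoharan–Brenner / Holmes-Cerfon enumeration (the cell's STEP-0 file `step0/clusters-n7.jsonl`).
Proof: a ball with three or four contacts exists (`C(6) = 12`, degree sum `30`); relabel it to `6` with its neighbours last
(`exists_relabel7`); the kernel search (`SevenCensusSearch.lean`) yields a good pattern EQUAL to the contact graph or a bad
pattern INSIDE it, and the bad ones are impossible: `K₅` (`no_contact_clique_five`), `K_{3,3}`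
(`card_common_contactNeighbors_three_le_two'`), the bridged fan (`no_tetra_fan_bridge`, `TetraFan.lean`), the prism link
(`no_prism_link`, `PrismLink.lean`). Realisability of the five graphs is NOT asserted here (the cell's exact certificates
realise them; formal witnesses are future work), so this is the "at most these five" half of the census.

HONEST FRAMING: kernel-checked combinatorics plus folklore solid geometry (standard axioms, no `native_decide`); no claim about
crystallization.
-/

noncomputable section

open Finset
open scoped BigOperators

namespace Summit.Ventures.Crystal3D

open SevenSearch SevenCensus

/-! ### 1. Relabelling tools on `Fin 7` -/

/-- A vertex `w` with a set `N` of `d ≤ 6` "neighbours" (`w ∉ N`) can be moved to `6` with `N` occupying the last `d` labels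
below `6`: a bijection `g` with `g 6 = w` and, for `j ≠ 6`, `g j ∈ N ↔ 6 - d ≤ j`. [folklore] -/
theorem exists_relabel7 (N : Finset (Fin 7)) (w : Fin 7) (hwN : w ∉ N) {d : ℕ} (hN : N.card = d) (hd : d ≤ 6) :
    ∃ g : Fin 7 ≃ Fin 7, g 6 = w ∧ ∀ j : Fin 7, j ≠ 6 → (g j ∈ N ↔ 6 - d ≤ j.val) := by
  classical
  set R : Finset (Fin 7) := univ \ insert w N with hRdef
  have hR : R.card = 6 - d := by
    rw [hRdef, card_univ_sdiff, Fintype.card_fin, card_insert_of_notMem hwN, hN]; omega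
  let g : Fin 7 → Fin 7 := fun j =>
    if h1 : j.val < 6 - d then R.orderEmbOfFin hR ⟨j.val, h1⟩
    else if h2 : j.val < 6 then N.orderEmbOfFin hN ⟨j.val - (6 - d), by omega⟩ else w
  have gR : ∀ j : Fin 7, ∀ h1 : j.val < 6 - d, g j = R.orderEmbOfFin hR ⟨j.val, h1⟩ := fun j h1 => by
    simp only [g, dif_pos h1]
  have gN : ∀ j : Fin 7, ∀ h1 : ¬ j.val < 6 - d, ∀ h2 : j.val < 6,
      g j = N.orderEmbOfFin hN ⟨j.val - (6 - d), by omega⟩ :=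
    fun j h1 h2 => by simp only [g, dif_neg h1, dif_pos h2]
  have g6 : ∀ j : Fin 7, ¬ j.val < 6 → g j = w := fun j h2 => by
    simp only [g, dif_neg (show ¬ j.val < 6 - d by omega), dif_neg h2]
  have memR : ∀ j : Fin 7, j.val < 6 - d → g j ∈ R := fun j h1 => by rw [gR j h1]; exact R.orderEmbOfFin_mem hR _
  have memN : ∀ j : Fin 7, ¬ j.val < 6 - d → j.val < 6 → g j ∈ N := fun j h1 h2 => by
    rw [gN j h1 h2]; exact N.orderEmbOfFin_mem hN _
  have hRN : ∀ v, v ∈ R → v ∉ N := fun v hv hvN => by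
    rw [hRdef, mem_sdiff] at hv; exact hv.2 (mem_insert_of_mem hvN)
  have hRw : ∀ v, v ∈ R → v ≠ w := fun v hv hvw => by
    rw [hRdef, mem_sdiff] at hv; exact hv.2 (hvw ▸ mem_insert_self _ _)
  have hinj : Function.Injective g := by
    intro i j hij
    by_cases hi1 : i.val < 6 - d <;> by_cases hj1 : j.val < 6 - d
    · have e : (⟨i.val, hi1⟩ : Fin (6 - d)) = ⟨j.val, hj1⟩ := by
        apply (R.orderEmbOfFin hR).injective; rw [← gR i hi1, ← gR j hj1, hij]
      exact Fin.ext (by simpa using e)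
    · exfalso
      by_cases hj2 : j.val < 6
      · exact hRN _ (memR i hi1) (hij ▸ memN j hj1 hj2)
      · exact hRw _ (memR i hi1) (hij.trans (g6 j hj2))
    · exfalso
      by_cases hi2 : i.val < 6
      · exact hRN _ (memR j hj1) (hij.symm ▸ memN i hi1 hi2)
      · exact hRw _ (memR j hj1) (hij.symm.trans (g6 i hi2))
    · by_cases hi2 : i.val < 6 <;> by_cases hj2 : j.val < 6
      · have e : (⟨i.val - (6 - d), by omega⟩ : Fin d) = ⟨j.val - (6 - d), by omega⟩ := by
          apply (N.orderEmbOfFin hN).injective; rw [← gN i hi1 hi2, ← gN j hj1 hj2, hij]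
        have e' : i.val - (6 - d) = j.val - (6 - d) := by simpa using e
        exact Fin.ext (by omega)
      · exfalso; exact hwN ((g6 j hj2) ▸ hij ▸ memN i hi1 hi2)
      · exfalso; exact hwN ((g6 i hi2) ▸ hij.symm ▸ memN j hj1 hj2)
      · exact Fin.ext (by omega)
  refine ⟨Equiv.ofBijective g (Finite.injective_iff_bijective.1 hinj), g6 6 (by decide), fun j hj => ?_⟩
  rw [Equiv.ofBijective_apply]
  by_cases h1 : j.val < 6 - d
  · constructor
    · intro h; exact absurd h (hRN _ (memR j h1))
    · intro h; omega
  · have h2 : j.val < 6 := by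
      have := j.isLt
      have hne : j.val ≠ 6 := fun h => hj (Fin.ext h)
      omega
    exact ⟨fun _ => by omega, fun _ => memN j h1 h2⟩

/-- Coordination numbers are relabelling-invariant: `coordination (x ∘ g) i = coordination x (g i)`. [folklore] -/
theorem coordination_comp_equiv {N d : ℕ} (x : Fin N → EuclideanSpace ℝ (Fin d)) (g : Fin N ≃ Fin N) (i : Fin N) :
    coordination (x ∘ g) i = coordination x (g i) := by
  classical
  unfold coordination
  rw [← Finset.card_map g.toEmbedding]
  congr 1
  ext j
  simp only [Finset.mem_map_equiv, mem_contactNeighbors, Function.comp_apply, Equiv.apply_symm_apply]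
  constructor
  · rintro ⟨hne, hd⟩
    exact ⟨fun h => hne (by simp [h]), hd⟩
  · rintro ⟨hne, hd⟩
    exact ⟨fun h => hne (by simp [← h]), hd⟩

/-- Contact numbers are relabelling-invariant. [folklore] -/
theorem numContacts_comp_equiv {N d : ℕ} (x : Fin N → EuclideanSpace ℝ (Fin d)) (g : Fin N ≃ Fin N) :
    numContacts (x ∘ g) = numContacts x := by
  have h1 := sum_coordination_eq (x ∘ g)
  have h2 := sum_coordination_eq x
  have h3 : ∑ i, coordination (x ∘ g) i = ∑ i, coordination x i := by
    simp only [coordination_comp_equiv]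
    exact Equiv.sum_comp g (fun i => coordination x i)
  omega

/-- `pidx` is injective on increasing pairs of `Fin 7`. [folklore] -/
theorem SevenSearch.pidx_inj : ∀ a b c e : V, a < b → c < e → pidx a b = pidx c e → a = c ∧ b = e := by decide

/-- Equal slots come from equal unordered pairs. [folklore] -/
theorem SevenSearch.pidx_eq_cases : ∀ a b c e : V, a ≠ b → c < e → pidx a b = pidx c e →
    (a = c ∧ b = e) ∨ (a = e ∧ b = c) := by decide

/-- Slots at vertex `6` are `15 + j`. [folklore] -/
theorem SevenSearch.pidx_six : ∀ j : V, j ≠ 6 → pidx j 6 = 15 + j.val := by decide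

/-- Slots below `15` are exactly the pairs avoiding vertex `6`. [folklore] -/
theorem SevenSearch.pidx_lt_fifteen : ∀ a b : V, a ≠ b → (pidx a b < 15 ↔ a ≠ 6 ∧ b ≠ 6) := by decide

/-- Bits of `∑_{i∈S} 2^i`: set exactly on `S`. [folklore] -/
theorem testBit_sum_two_pow_iff {S : Finset ℕ} {j : ℕ} : (∑ i ∈ S, 2 ^ i).testBit j = true ↔ j ∈ S := by
  constructor
  · intro ht
    have h2 : j ∈ (∑ i ∈ S, 2 ^ i).bitIndices.toFinset := by rw [List.mem_toFinset, Nat.mem_bitIndices]; exact ht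
    rwa [Finset.toFinset_bitIndices_sum_two_pow] at h2
  · exact SevenSearch.testBit_sum_two_pow_of_mem

/-! ### 2. The census -/

/-- **The seven-ball census at graph level.** Every packing of seven unit-diameter balls with exactly fifteen contacts has,
after relabelling, EXACTLY the contact pairs of a labelled copy of one of the five graphs `bipyr`, `axial`, `tricap`,
`capoct`, `helix` (the good patterns of `SevenCensus.patList`): for all labels `a ≠ b`, the relabelled balls `a, b` touch iff
the slot `pidx a b` is an edge slot of the pattern. [folklore] -/
theorem seven_census {x : Fin 7 → EuclideanSpace ℝ (Fin 3)} (hx : IsUnitPacking x) (h15 : numContacts x = 15) :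
    ∃ g : Fin 7 ≃ Fin 7, ∃ p ∈ SevenCensus.patList, p.good = true ∧
      ∀ a b : Fin 7, a ≠ b → (dist (x (g a)) (x (g b)) = 1 ↔ (maskOf p.edges).testBit (pidx a b) = true) := by
  classical
  -- 1. a ball with three or four contacts
  obtain ⟨w, hw3, hw4⟩ : ∃ w, 3 ≤ coordination x w ∧ coordination x w ≤ 4 := by
    have hsum := sum_coordination_eq x
    rw [h15] at hsum
    have hlow : ∀ v, 3 ≤ coordination x v := by
      intro v
      have h := numContacts_le_add_maxContacts hx (le_refl (coordination x v))
      rw [h15, maxContacts_three_six] at h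
      omega
    by_contra hno
    push Not at hno
    have h5 : ∀ v, 5 ≤ coordination x v := fun v => by
      have h1 := hlow v
      have h2 := hno v h1
      omega
    have h35 : 35 ≤ ∑ v, coordination x v :=
      calc (35 : ℕ) = ∑ _v : Fin 7, 5 := by simp
        _ ≤ ∑ v, coordination x v := Finset.sum_le_sum fun v _ => h5 v
    omega
  -- 2. relabel: `g 6 = w`, neighbours of `w` last
  set d := coordination x w with hddef
  obtain ⟨g, hg6, hgN⟩ := exists_relabel7 (contactNeighbors x w) w (not_mem_contactNeighbors_self x w) hddef.symm
    (by omega)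
  set y : Fin 7 → EuclideanSpace ℝ (Fin 3) := x ∘ g with hydef
  have hy : IsUnitPacking y := hx.comp g.injective
  have h15y : numContacts y = 15 := by rw [hydef, numContacts_comp_equiv, h15]
  have hy6 : ∀ j : Fin 7, j ≠ 6 → (dist (y j) (y 6) = 1 ↔ 6 - d ≤ j.val) := by
    intro j hj
    rw [← hgN j hj, mem_contactNeighbors, hydef, Function.comp_apply, Function.comp_apply, hg6, dist_comm]
    exact ⟨fun h => ⟨fun h' => hj (g.injective (h'.trans hg6.symm)), h⟩, fun h => h.2⟩
  -- 3. missing slots of `y`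
  set NC : Finset (Fin 7 × Fin 7) := univ.filter fun p => p.1 < p.2 ∧ dist (y p.1) (y p.2) ≠ 1 with hNC
  set M : Finset ℕ := NC.image fun p => pidx p.1 p.2 with hMdef
  have hLT : (univ.filter fun p : Fin 7 × Fin 7 => p.1 < p.2).card = 21 := by decide
  have hunion : contactPairs y ∪ NC = univ.filter fun p : Fin 7 × Fin 7 => p.1 < p.2 := by
    ext p
    simp only [mem_union, mem_contactPairs, hNC, mem_filter, mem_univ, true_and]
    tauto
  have hdisj : Disjoint (contactPairs y) NC := by
    rw [Finset.disjoint_left]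
    intro p hp hq
    rw [mem_contactPairs] at hp
    rw [hNC, mem_filter] at hq
    exact hq.2.2 hp.2
  have hNCcard : NC.card = 6 := by
    have h := card_union_of_disjoint hdisj
    rw [hunion, hLT] at h
    unfold numContacts at h15y
    omega
  have hMcard : M.card = 6 := by
    rw [hMdef, card_image_of_injOn, hNCcard]
    intro p hp q hq hpq
    rw [mem_coe, hNC, mem_filter] at hp hq
    have h := SevenSearch.pidx_inj p.1 p.2 q.1 q.2 hp.2.1 hq.2.1 hpq
    exact Prod.ext h.1 h.2
  have hcon : ∀ a b : Fin 7, a ≠ b → (dist (y a) (y b) = 1 ↔ pidx a b ∉ M) := by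
    intro a b hab
    constructor
    · intro hd hmem
      obtain ⟨p, hp, hpe⟩ := mem_image.1 hmem
      rw [hNC, mem_filter] at hp
      rcases SevenSearch.pidx_eq_cases a b p.1 p.2 hab hp.2.1 hpe.symm with ⟨rfl, rfl⟩ | ⟨rfl, rfl⟩
      · exact hp.2.2 hd
      · exact hp.2.2 (by rw [dist_comm]; exact hd)
    · intro hS
      by_contra hd
      apply hS
      rcases lt_or_gt_of_ne hab with hlt | hlt
      · exact mem_image.2 ⟨(a, b), by rw [hNC, mem_filter]; exact ⟨mem_univ _, hlt, hd⟩, rfl⟩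
      · have hd' : dist (y b) (y a) ≠ 1 := fun h => hd (by rw [dist_comm]; exact h)
        exact mem_image.2 ⟨(b, a), by rw [hNC, mem_filter]; exact ⟨mem_univ _, hlt, hd'⟩, pidx_comm b a⟩
  -- slots at vertex 6: missing iff `j < 6 - d`
  have h6slot : ∀ j : Fin 7, j ≠ 6 → (pidx j 6 ∈ M ↔ j.val < 6 - d) := by
    intro j hj
    have h := hcon j 6 hj
    rw [hy6 j hj] at h
    constructor
    · intro hm; by_contra hlt; exact (h.1 (by omega)) hm
    · intro hlt; by_contra hm; have := h.2 hm; omega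
  have hMlt : ∀ i ∈ M, i < 15 ∨ ∃ j : Fin 7, j ≠ 6 ∧ j.val < 6 - d ∧ i = 15 + j.val := by
    intro i hi
    obtain ⟨p, hp, rfl⟩ := mem_image.1 hi
    rw [hNC, mem_filter] at hp
    obtain ⟨-, hlt, hne1⟩ := hp
    have hne : p.1 ≠ p.2 := ne_of_lt hlt
    by_cases h2 : p.2 = 6
    · have h1 : p.1 ≠ 6 := fun h => hne (h.trans h2.symm)
      right
      refine ⟨p.1, h1, ?_, by rw [h2, SevenSearch.pidx_six p.1 h1]⟩
      have hm : pidx p.1 6 ∈ M := by rw [← h2]; exact hi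
      exact (h6slot p.1 h1).1 hm
    · have h1 : p.1 ≠ 6 := by
        intro h
        have h' : p.1.val < p.2.val := hlt
        have := p.2.isLt
        rw [h] at h'
        simp at h'
        omega
      exact Or.inl ((SevenSearch.pidx_lt_fifteen p.1 p.2 hne).2 ⟨h1, h2⟩)
  have hbase : ∀ j : Fin 7, j ≠ 6 → j.val < 6 - d → 15 + j.val ∈ M := by
    intro j hj hlt
    rw [← SevenSearch.pidx_six j hj]
    exact (h6slot j hj).2 hlt
  -- 4. the search
  have hsearch : ∃ p ∈ SevenCensus.patList, (p.good = true ∧ maskOf p.edges = ALL ^^^ (∑ i ∈ M, 2 ^ i)) ∨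
      (p.good = false ∧ ∀ e ∈ p.edges, pidx e.1 e.2 ∉ M) := by
    rcases Nat.lt_or_ge d 4 with hd3 | hd4
    · have hd : d = 3 := by omega
      refine exists_patternA M (fun i hi => ?_) (hbase 0 (by decide) (by rw [hd]; decide))
        (hbase 1 (by decide) (by rw [hd]; decide)) (hbase 2 (by decide) (by rw [hd]; decide)) hMcard
      rcases hMlt i hi with h | ⟨j, -, hj, rfl⟩
      · exact Or.inl h
      · right; rw [hd] at hj; omega
    · have hd : d = 4 := by omega
      refine exists_patternB M (fun i hi => ?_) (hbase 0 (by decide) (by rw [hd]; decide))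
        (hbase 1 (by decide) (by rw [hd]; decide)) hMcard
      rcases hMlt i hi with h | ⟨j, -, hj, rfl⟩
      · exact Or.inl h
      · right; rw [hd] at hj; omega
  obtain ⟨p, hp, hcase⟩ := hsearch
  rcases hcase with ⟨hgood, hmask⟩ | ⟨hbad, hfree⟩
  · -- a good pattern: its edge slots are exactly the non-missing slots, i.e. the contacts
    refine ⟨g, p, hp, hgood, fun a b hab => ?_⟩
    show dist (y a) (y b) = 1 ↔ _
    rw [hcon a b hab, hmask, Nat.testBit_xor, ALL, Nat.testBit_two_pow_sub_one]
    have hlt : pidx a b < 21 := pidx_lt a b hab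
    rw [decide_eq_true hlt]
    constructor
    · intro hnot
      have : (∑ i ∈ M, 2 ^ i).testBit (pidx a b) = false := by
        rw [Bool.eq_false_iff]; intro h; exact hnot (testBit_sum_two_pow_iff.1 h)
      rw [this]; rfl
    · intro h hmem
      rw [testBit_sum_two_pow_iff.2 hmem] at h
      exact Bool.noConfusion h
  · -- a bad pattern: contradiction
    exfalso
    have hv := patList_valid p hp
    have hv1 : ∀ e ∈ p.edges, e.1 ≠ e.2 := fun e he => hv e (List.mem_append_left _ he)
    have hv2 : ∀ e ∈ p.non, e.1 ≠ e.2 := fun e he => hv e (List.mem_append_right _ he)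
    have H1 : ∀ e ∈ p.edges, dist (y e.1) (y e.2) = 1 := fun e he => (hcon _ _ (hv1 e he)).2 (hfree e he)
    have H2 : ∀ e ∈ p.non, 1 ≤ dist (y e.1) (y e.2) := fun e he => hy.one_le_dist (hv2 e he)
    clear hfree hv
    cases p with
    | k5 t =>
      obtain ⟨a, b, c, d', e⟩ := t
      simp only [Pat.edges, k5Edges, List.forall_mem_cons, List.not_mem_nil, false_implies, implies_true,
        and_true] at H1 hv1
      obtain ⟨hab, hac, had, hae, hbc, hbd, hbe, hcd, hce, hde⟩ := H1
      obtain ⟨nab, nac, nad, nae, nbc, nbd, nbe, ncd, nce, nde⟩ := hv1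
      have hc5 : ({a, b, c, d', e} : Finset (Fin 7)).card = 5 := by
        rw [card_insert_of_notMem (by simp [nab, nac, nad, nae]), card_insert_of_notMem (by simp [nbc, nbd, nbe]),
          card_insert_of_notMem (by simp [ncd, nce]), card_pair nde]
      refine no_contact_clique_five y {a, b, c, d', e} hc5 fun i hi j hj hij => ?_
      simp only [mem_insert, mem_singleton] at hi hj
      rcases hi with rfl | rfl | rfl | rfl | rfl <;> rcases hj with rfl | rfl | rfl | rfl | rfl <;>
        first
        | exact absurd rfl hij
        | assumption
        | (rw [dist_comm]; assumption)
    | k33 t =>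
      obtain ⟨a, b, c, d', e, f⟩ := t
      simp only [Pat.edges, Pat.non, k33Edges, k33Non, List.forall_mem_cons, List.not_mem_nil, false_implies,
        implies_true, and_true] at H1 hv1 hv2
      obtain ⟨had, hae, haf, hbd, hbe, hbf, hcd, hce, hcf⟩ := H1
      obtain ⟨nad, nae, naf, nbd, nbe, nbf, ncd, nce, ncf⟩ := hv1
      obtain ⟨nab, nac, nbc, nde, ndf, nef⟩ := hv2
      have hsub : ({d', e, f} : Finset (Fin 7)) ⊆ contactNeighbors y a ∩ contactNeighbors y b ∩ contactNeighbors y c := by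
        intro j hj
        simp only [mem_insert, mem_singleton] at hj
        simp only [mem_inter, mem_contactNeighbors]
        rcases hj with rfl | rfl | rfl
        · exact ⟨⟨⟨nad.symm, had⟩, nbd.symm, hbd⟩, ncd.symm, hcd⟩
        · exact ⟨⟨⟨nae.symm, hae⟩, nbe.symm, hbe⟩, nce.symm, hce⟩
        · exact ⟨⟨⟨naf.symm, haf⟩, nbf.symm, hbf⟩, ncf.symm, hcf⟩
      have h3 : ({d', e, f} : Finset (Fin 7)).card = 3 := by
        rw [card_insert_of_notMem (by simp [nde, ndf]), card_pair nef]
      have h2 := card_common_contactNeighbors_three_le_two' hy nab nac nbc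
      have h3' := card_le_card hsub
      rw [h3] at h3'
      omega
    | fan t =>
      obtain ⟨h, q, v2, v0, v3, v1, w'⟩ := t
      simp only [Pat.edges, Pat.non, fanEdges, fanNon, List.forall_mem_cons, List.not_mem_nil, false_implies,
        implies_true, and_true] at H1 H2
      obtain ⟨hhq, hh2, hh0, hh3, hh1, hq2, hq0, hq3, hq1, h20, h03, h31, hwh, hw1, hw2⟩ := H1
      obtain ⟨h23, h01, hwq⟩ := H2
      exact no_tetra_fan_bridge hhq hh2 hh0 hh3 hh1 hq2 hq0 hq3 hq1 h20 h03 h31 hwh hw1 hw2 h23 h01 hwq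
    | prism t =>
      obtain ⟨h, a, b, c, a', b', c'⟩ := t
      simp only [Pat.edges, Pat.non, prismEdges, prismNon, List.forall_mem_cons, List.not_mem_nil, false_implies,
        implies_true, and_true] at H1 H2
      obtain ⟨hha, hhb, hhc, hha', hhb', hhc', hab, hac, hbc, ha'b', ha'c', hb'c', haa', hbb', hcc'⟩ := H1
      obtain ⟨hab', hac', hba', hbc', hca', hcb'⟩ := H2
      exact no_prism_link hha hhb hhc hha' hhb' hhc' hab hac hbc ha'b' ha'c' hb'c' haa' hbb' hcc' hab' hac' hba' hbc' hca'
        hcb'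
    | bipyr t => exact Bool.noConfusion hbad
    | axial t => exact Bool.noConfusion hbad
    | tricap t => exact Bool.noConfusion hbad
    | capoct t => exact Bool.noConfusion hbad
    | helix t => exact Bool.noConfusion hbad

end Summit.Ventures.Crystal3D

end
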